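/-
Literature/Probability/FitznerVanDerHofstad2017/SrwWSplitJensenKernel.lean   (NEW, additive, d-generic)

b2b-lace lean1-g22, node N67-S2-K2d-K: the KERNEL side of the product-Jensen `W`-split far node — a
`decide +kernel`-evaluable rational majorant `jensenBoundQ` of the Jensen sum `J_{1,l}(x)` of
`SrwWSplitJensen`, read off an origin `I`-table (hypothesis `hT`, any extent) and the SRW law, memoised by the
type of the doubled restriction; and the `WBX` cell with these far values (`jensenFarQ`), kernel-certifiable order by
order exactly like `WbxCellExactKernel.…_le_policyXBounds_of_originTable`.
What-if / input-certification lane: no statement about any dimension; the record (CERT REV 14) is untouched.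
-/
import Literature.Probability.FitznerVanDerHofstad2017.SrwWSplitJensen
import Literature.Probability.FitznerVanDerHofstad2017.WbxCellExactKernel
import HarnessLib

/-!
# Kernel majorant of the Jensen sum and the `WBX` cell with `W`-split far values

* §1 `signedPermInvariant_srwI`, `srwI_eq_of_absCountVec_eq`: `I_{n,l}` is constant on hyperoctahedral classes,
  a class being decided by the profile vector `absCountVec r` inside the box `|y_μ| ≤ r`.
* §2 `srwIPosBoundQ d y l N Λ T = srwLawPartialQ d |y| l N + srwIZeroExtQ d Λ T (l+N)` (positional absolute
  coordinate list) and `srwI_one_le_srwIPosBoundQ`: `I_{1,l}(y) ≤ ↑(srwIPosBoundQ …)` from an origin table `hT`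
  (`SrwOriginTailKernel.srwI_one_le_partialQ_add_extQ`).
* §3 `jensenBoundQ d x l N tmax Λ T`: `2^{-s} Σ_{U ⊆ supp x}` of a table value looked up BY PROFILE in a memo table
  with one entry per type `t ≤ m` of doubled restriction (representative `canonSite`, literal coordinate list
  `coordListN`, value `srwLawPartialQ + srwIZeroExtQ (l+N)`), guarded in the kernel by the profile test (a miss or
  a failed guard falls back on the `x`-uniform cap `srwIZeroExtQ d Λ T l ≥ I_{1,l}(0)`);
  (a subset with more than `tmax` doubled coordinates is looked up through its truncation `truncTo U tmax` — cost
  knob, sound by Lemma 5.1 `srwI_dblOn_le_of_subset`);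
  `jensenSum_le_jensenBoundQ`: `J_{1,l}(x) ≤ ↑(jensenBoundQ …)` for EVERY `x`, `l`, `N`, `tmax` (`d ≥ 3`, `hT`).
* §4 `jensenFarQ d Λ T N tmax J i l` = one Newton step for `√(AB)` from the arithmetic mean,
  `A = srwIZeroExtQ d Λ T (2J)`, `B = jensenBoundQ d (canonSite d l) (2J) N tmax Λ T`;
  `srwK_le_jensenFarQ`: `K_{1,2J}(x_l) ≤ ↑(jensenFarQ …)` ((5.16) in
  the certificate form `AB ≤ F²` of `SrwWSplitJensen.srwK_le_of_jensen_cert`) and the cell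
  `toReal_tsum_sq_weighted_repBubble_le_policyXBounds_jensen_of_originTable`: the binders of
  `WbxCellExactKernel.…_le_policyXBounds_of_originTable` verbatim, the far values now `jensenFarQ`;
  §4b the chunkable table form: `jensenFarLeTable` (`Bool`: `jensenFarQ … i l ≤ f l` on a class list),
  `jensenFarLeTable_of_take_drop`, `srwK_le_of_jensenFarLeTable`, and the cell `…_jensenTable_of_originTable` run on a
  certified far-value table `f`.
* §5 toy examples (`d = 3`), kernel-decided.

All statements are `d`-generic.  Pointer language only.

References: [FvdH-NoBLE] R. Fitzner, R. van der Hofstad, PTRF 169 (2017), §5.1.2 (5.16), §5.3; [FvdH17] EJP 22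
(2017) no. 43, §4.2.
-/

namespace Literature.Probability.FitznerVanDerHofstad2017

open _root_.MeasureTheory Finset
open Literature.Barriers.CriticalPhenomena Literature.Probability.Percolation
open Literature.Probability.LatticeModels
open SrwCount (coordD)
open scoped BigOperators ENNReal

variable {d : ℕ}

/-! ### §1. `I_{n,l}` is a class function -/

/-- `I_{n,l}(x)` is invariant under signed coordinate permutations. [cite: FitznerVanDerHofstad2016NoBLE, (3.35)–(3.36) p. 1071] -/
theorem signedPermInvariant_srwI (n l : ℕ) : SignedPermInvariant (fun x : Site d => srwI d n l x) := by
  intro σ ε x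
  have h : spAct ((σ.symm, ε) : SgnPermPair d) x = Site.signedPerm σ ε x := by
    rw [spAct_eq_signedPerm]; simp
  show srwI d n l (Site.signedPerm σ ε x) = srwI d n l x
  rw [← h, srwI_spAct]

/-- Two points of the box `|·| ≤ r` with the same profile vector have the same `I_{n,l}`.
[cite: FitznerVanDerHofstad2016NoBLE, §5.3.3 p. 1098 (one representative per class)] -/
theorem srwI_eq_of_absCountVec_eq {r : ℕ} {x y : Site d} (hx : ∀ μ, (x μ).natAbs ≤ r)
    (hy : ∀ μ, (y μ).natAbs ≤ r) (h : absCountVec r x = absCountVec r y) (n l : ℕ) :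
    srwI d n l x = srwI d n l y := by
  have hj : ∀ j, absCount x j = absCount y j := by
    intro j
    by_cases hjr : j ≤ r
    · exact congrFun h ⟨j, Nat.lt_succ_of_le hjr⟩
    · rw [absCount_eq_zero_of_lt hx (not_le.1 hjr), absCount_eq_zero_of_lt hy (not_le.1 hjr)]
  obtain ⟨σ, ε, rfl⟩ := exists_signedPerm_of_absCount_eq hj
  exact ((signedPermInvariant_srwI n l) σ ε x).symm

/-! ### §2. The positional law-plus-tail bound at one point -/

/-- The positional list of absolute coordinates `(|y_0|, …, |y_{d-1}|)`. [folklore] -/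
def absPosList (y : Fin d → ℤ) : List ℕ := List.ofFn fun i => (y i).natAbs

/-- The positional hypothesis of `SrwOriginTailKernel.srwI_one_le_partialQ_add_extQ` at any point.
[cite: FitznerVanDerHofstad2016NoBLE, §5.1.1 (5.4)–(5.5) pp. 1089–1090] -/
theorem natAbs_coordD_eq_getD_absPosList (y : Fin d → ℤ) (j : ℕ) :
    (coordD y j).natAbs = (absPosList y).getD j 0 := by
  unfold coordD absPosList
  by_cases hj : j < d
  · rw [dif_pos hj, List.getD_eq_getElem?_getD, List.getElem?_ofFn]
    simp [hj]
  · rw [dif_neg hj, List.getD_eq_getElem?_getD, List.getElem?_ofFn]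
    simp [hj]

/-- `srwIPosBoundQ d y l N Λ T = Σ_{l ≤ i < l+N} p_i(y; d) + (extended origin column at l+N)`, exact rational.
[cite: FitznerVanDerHofstad2016NoBLE, §5.1.1 (5.4)–(5.5) pp. 1089–1090; (5.14) p. 1092] -/
def srwIPosBoundQ (d : ℕ) (y : Fin d → ℤ) (l N Λ : ℕ) (T : ℕ → ℚ) : ℚ :=
  srwLawPartialQ d (absPosList y) l N + srwIZeroExtQ d Λ T (l + N)

/-- **`I_{1,l}(y) ≤ ↑(srwIPosBoundQ d y l N Λ T)`** from an upper origin table `T` of extent `Λ` (`d ≥ 3`).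
[cite: FitznerVanDerHofstad2016NoBLE, §5.1.1 (5.4)–(5.5); (5.14) p. 1092] -/
theorem srwI_one_le_srwIPosBoundQ (hd : 3 ≤ d) {Λ : ℕ} {T : ℕ → ℚ} (hT : ∀ l ≤ Λ, srwI d 1 l 0 ≤ (T l : ℝ))
    (y : Fin d → ℤ) (l N : ℕ) : srwI d 1 l y ≤ ((srwIPosBoundQ d y l N Λ T : ℚ) : ℝ) := by
  rw [srwIPosBoundQ, Rat.cast_add]
  exact srwI_one_le_partialQ_add_extQ hd (by simp [absPosList]) (natAbs_coordD_eq_getD_absPosList y) hT l N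

/-! ### §3. The memoised kernel majorant of the Jensen sum -/

/-- The largest absolute coordinate. [folklore] -/
def maxAbs (x : Fin d → ℤ) : ℕ := Finset.univ.sup fun i => (x i).natAbs

/-- Interleave zeros: the multiplicity list of the doubled type `t = (t_1, …, t_R)` — value `2a` with multiplicity
`t_a`, odd values absent: `[0, t_1, 0, t_2, …]`. [folklore] -/
def doubledMult : List ℕ → List ℕ
  | [] => []
  | t :: ts => 0 :: t :: doubledMult ts

/-- The ℕ-valued coordinate list of a canonical point: `coordListN w [a, b, …] = w^a (w+1)^b …` (literal numerals,
cheap to re-read in the kernel). [folklore] -/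
def coordListN : ℕ → List ℕ → List ℕ
  | _, [] => []
  | w, a :: t => List.replicate a w ++ coordListN (w + 1) t

/-- `|coordList w L| = coordListN w L`. [cite: FitznerVanDerHofstad2016NoBLE, §5.3.3 p. 1098 (one representative per class)] -/
theorem map_natAbs_coordList (w : ℕ) (L : List ℕ) : (coordList w L).map Int.natAbs = coordListN w L := by
  induction L generalizing w with
  | nil => rfl
  | cons a t ih =>
    simp only [coordList, coordListN, List.map_append, List.map_replicate, Int.natAbs_natCast, ih]

/-- Same length. [cite: FitznerVanDerHofstad2016NoBLE, §5.3.3 p. 1098 (one representative per class)] -/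
theorem length_coordListN (w : ℕ) (L : List ℕ) : (coordListN w L).length = (coordList w L).length := by
  rw [← map_natAbs_coordList, List.length_map]

/-- The positional hypothesis of `SrwOriginTailKernel.srwI_one_le_partialQ_add_extQ` at a canonical point.
[cite: FitznerVanDerHofstad2016NoBLE, §5.1.1 (5.4)–(5.5) pp. 1089–1090; §5.3.3 p. 1098] -/
theorem natAbs_coordD_canonSite {L : List ℕ} (hL : (coordListN 1 L).length ≤ d) (j : ℕ) :
    (coordD (canonSite d L) j).natAbs = (coordListN 1 L).getD j 0 := by
  rw [← map_natAbs_coordList]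
  unfold coordD canonSite
  by_cases hj : j < d
  · rw [dif_pos hj, show (0 : ℕ) = Int.natAbs 0 from rfl, List.getD_map]
  · rw [dif_neg hj, Int.natAbs_zero, List.getD_eq_default]
    rw [length_coordListN] at hL
    rw [List.length_map]
    omega

/-- The memo table: one entry `(representative, its coordinate list, value)` per type `t ≤ m` of doubled restriction
of `x` (`m_a = #{μ : |x_μ| = a}`, `1 ≤ a ≤ maxAbs x`): the representative is the canonical point of the doubled type,
the value its SRW-law partial sum plus the extended origin column at `l + N`. [folklore] -/
def jensenMemo (d : ℕ) (x : Fin d → ℤ) (l N Λ : ℕ) (T : ℕ → ℚ) : List ((Fin d → ℤ) × List ℕ × ℚ) :=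
  (((List.range (maxAbs x)).map fun a => List.range (absCount x (a + 1) + 1)).sections).map fun t =>
    (canonSite d (doubledMult t), coordListN 1 (doubledMult t),
      srwLawPartialQ d (coordListN 1 (doubledMult t)) l N + srwIZeroExtQ d Λ T (l + N))

/-- One term of the Jensen sum, read off the memo table under the kernel profile guard (box, profile vector, list
length); a failed guard falls back on the `x`-uniform cap. [folklore] -/
def jensenTermQ (d : ℕ) (x : Fin d → ℤ) (l Λ : ℕ) (T : ℕ → ℚ) (memo : List ((Fin d → ℤ) × List ℕ × ℚ))
    (U : Finset (Fin d)) : ℚ :=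
  match memo.find? fun e =>
      decide (e.2.1.length ≤ d ∧ (∀ μ, (dblOn x U μ).natAbs ≤ 2 * maxAbs x) ∧
        (∀ μ, (e.1 μ).natAbs ≤ 2 * maxAbs x) ∧
        absCountVec (2 * maxAbs x) (dblOn x U) = absCountVec (2 * maxAbs x) e.1) with
  | some e => e.2.2
  | none => srwIZeroExtQ d Λ T l

/-- The first `tmax` elements of `U` (all of `U` when `#U ≤ tmax`): the COST KNOB of the evaluator — a subset with more
than `tmax` doubled coordinates is bounded through its truncation (`I_{1,l}(2x|_U) ≤ I_{1,l}(2x|_{U'})` for `U' ⊆ U`,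
Lemma 5.1), so that only the types with at most `tmax` doubled coordinates are ever evaluated.
[cite: FitznerVanDerHofstad2017, Lemma 5.1] -/
def truncTo {d : ℕ} (U : Finset (Fin d)) (tmax : ℕ) : Finset (Fin d) :=
  U.filter fun i => (U.filter (· < i)).card < tmax

/-- `truncTo U tmax ⊆ U`. [cite: FitznerVanDerHofstad2017, Lemma 5.1] -/
theorem truncTo_subset {d : ℕ} (U : Finset (Fin d)) (tmax : ℕ) : truncTo U tmax ⊆ U :=
  Finset.filter_subset _ _

/-- Shrinking the doubled set shrinks every coordinate in absolute value. [cite: FitznerVanDerHofstad2017, Lemma 5.1] -/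
theorem abs_dblOn_le_of_subset {x : Fin d → ℤ} {U U' : Finset (Fin d)} (h : U' ⊆ U) (μ : Fin d) :
    |dblOn x U' μ| ≤ |dblOn x U μ| := by
  by_cases h' : μ ∈ U'
  · simp [dblOn, h', h h']
  · simp [dblOn, h']

/-- **Monotonicity in the doubled set** (Lemma 5.1, `I`-clause): `U' ⊆ U ⟹ I_{1,l}(2x|_U) ≤ I_{1,l}(2x|_{U'})`
(`d ≥ 3`). [cite: FitznerVanDerHofstad2017, Lemma 5.1] -/
theorem srwI_dblOn_le_of_subset (hd : 3 ≤ d) {x : Fin d → ℤ} {U U' : Finset (Fin d)} (h : U' ⊆ U) (l : ℕ) :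
    srwI d 1 l (dblOn x U) ≤ srwI d 1 l (dblOn x U') :=
  absMonotone_srwI le_rfl (by omega) l _ _ (abs_dblOn_le_of_subset h)

/-- **`jensenBoundQ d x l N tmax Λ T`** — the kernel majorant of `J_{1,l}(x) = 2^{-s} Σ_{U ⊆ supp x} I_{1,l}(2x|_U)`:
every term is looked up, through its truncation to at most `tmax` doubled coordinates, in the type memo (`N` law terms
deep, then the origin tail). [cite: FitznerVanDerHofstad2016NoBLE, §5.1.2 (5.16) p. 1092] -/
def jensenBoundQ (d : ℕ) (x : Fin d → ℤ) (l N tmax Λ : ℕ) (T : ℕ → ℚ) : ℚ :=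
  let memo := jensenMemo d x l N Λ T
  (∑ U ∈ (nzSupp x).powerset, jensenTermQ d x l Λ T memo (truncTo U tmax)) / 2 ^ (nzSupp x).card

/-- Every memo entry is a canonical point with its own coordinate list and positional bound.
[cite: FitznerVanDerHofstad2016NoBLE, §5.1.2 (5.16) p. 1092; §5.3.3 p. 1098] -/
theorem mem_jensenMemo {x : Fin d → ℤ} {l N Λ : ℕ} {T : ℕ → ℚ} {e : (Fin d → ℤ) × List ℕ × ℚ}
    (he : e ∈ jensenMemo d x l N Λ T) : ∃ L : List ℕ, e = (canonSite d L, coordListN 1 L,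
      srwLawPartialQ d (coordListN 1 L) l N + srwIZeroExtQ d Λ T (l + N)) := by
  unfold jensenMemo at he
  obtain ⟨t, _, rfl⟩ := List.mem_map.1 he
  exact ⟨doubledMult t, rfl⟩

/-- One term is bounded by its table value (`d ≥ 3`, origin table `hT`). [cite: FitznerVanDerHofstad2016NoBLE, (5.14), (5.16) p. 1092] -/
theorem srwI_dblOn_le_jensenTermQ (hd : 3 ≤ d) {Λ : ℕ} {T : ℕ → ℚ} (hT : ∀ l ≤ Λ, srwI d 1 l 0 ≤ (T l : ℝ))
    (x : Fin d → ℤ) (l N : ℕ) (U : Finset (Fin d)) :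
    srwI d 1 l (dblOn x U) ≤ ((jensenTermQ d x l Λ T (jensenMemo d x l N Λ T) U : ℚ) : ℝ) := by
  unfold jensenTermQ
  split
  · rename_i e he
    have hp := List.find?_some he
    obtain ⟨L, rfl⟩ := mem_jensenMemo (List.mem_of_find?_eq_some he)
    simp only [decide_eq_true_eq] at hp
    obtain ⟨hlen, hU, he1, hvec⟩ := hp
    rw [srwI_eq_of_absCountVec_eq hU he1 hvec 1 l]
    push_cast
    exact srwI_one_le_partialQ_add_extQ hd hlen (natAbs_coordD_canonSite hlen) hT l N
  · exact (srwI_le_srwI_zero le_rfl (by omega) l (dblOn x U)).trans (srwI_one_zero_le_srwIZeroExtQ hd hT l)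

/-- **`J_{1,l}(x) ≤ ↑(jensenBoundQ d x l N tmax Λ T)`** for every `x`, `l`, `N`, `tmax` (`d ≥ 3`, origin table `hT`).
[cite: FitznerVanDerHofstad2016NoBLE, §5.1.2 (5.16) p. 1092] -/
theorem jensenSum_le_jensenBoundQ (hd : 3 ≤ d) {Λ : ℕ} {T : ℕ → ℚ} (hT : ∀ l ≤ Λ, srwI d 1 l 0 ≤ (T l : ℝ))
    (x : Fin d → ℤ) (l N tmax : ℕ) : jensenSum d 1 l x ≤ ((jensenBoundQ d x l N tmax Λ T : ℚ) : ℝ) := by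
  unfold jensenSum jensenBoundQ
  simp only []
  push_cast
  exact div_le_div_of_nonneg_right (Finset.sum_le_sum fun U _ =>
    (srwI_dblOn_le_of_subset hd (truncTo_subset U tmax) l).trans
      (srwI_dblOn_le_jensenTermQ hd hT x l N (truncTo U tmax))) (by positivity)

/-! ### §4. Far values and the `WBX` cell -/

/-- One Newton step for `√(AB)` started at the arithmetic mean: `((A+B)/2 + AB/((A+B)/2))/2` — a rational upper
bound of the geometric mean `√(AB)`, within a fraction of a percent of it in the regime of interest. [folklore] -/
def amgmNewton (A B : ℚ) : ℚ := ((A + B) / 2 + A * B / ((A + B) / 2)) / 2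

/-- The Newton value dominates the geometric mean: `0 ≤ A`, `0 ≤ B` ⟹ `0 ≤ F` and `A·B ≤ F²` for
`F = ((A+B)/2 + AB/((A+B)/2))/2` (over any linear ordered field) — the rational surrogate of the geometric mean in
(5.16). [cite: FitznerVanDerHofstad2016NoBLE, §5.1.2 (5.16) p. 1092] -/
theorem amgmNewton_spec {K : Type*} [Field K] [LinearOrder K] [IsStrictOrderedRing K] {A B : K} (hA : 0 ≤ A)
    (hB : 0 ≤ B) : 0 ≤ ((A + B) / 2 + A * B / ((A + B) / 2)) / 2 ∧
      A * B ≤ (((A + B) / 2 + A * B / ((A + B) / 2)) / 2) ^ 2 := by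
  set G := (A + B) / 2 with hG
  have hG0 : 0 ≤ G := by rw [hG]; positivity
  by_cases hz : G = 0
  · have hA0 : A = 0 := by rw [hG] at hz; linarith
    have hB0 : B = 0 := by rw [hG] at hz; linarith
    simp [hz, hA0, hB0]
  · have hGp : 0 < G := lt_of_le_of_ne hG0 (Ne.symm hz)
    refine ⟨by positivity, ?_⟩
    have key : ((G + A * B / G) / 2) ^ 2 - A * B = ((G - A * B / G) / 2) ^ 2 := by
      field_simp
      ring
    nlinarith [sq_nonneg ((G - A * B / G) / 2), key]

/-- The `W`-split/Jensen far value of class `l` at cut policy `J`: the Newton value of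
`A = srwIZeroExtQ d Λ T (2J_i(l))` (`≥ I_{1,2J}(0)`) and `B = jensenBoundQ d x_l (2J_i(l)) N tmax Λ T` (`≥ J_{1,2J}(x_l)`),
a rational `≥ √(AB) ≥ K_{1,2J}(x_l)`. [cite: FitznerVanDerHofstad2016NoBLE, §5.1.2 (5.16) p. 1092] -/
def jensenFarQ (d Λ : ℕ) (T : ℕ → ℚ) (N tmax : ℕ) (J : ℕ → List ℕ → ℕ) (i : ℕ) (l : List ℕ) : ℚ :=
  amgmNewton (srwIZeroExtQ d Λ T (2 * J i l)) (jensenBoundQ d (canonSite d l) (2 * J i l) N tmax Λ T)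

/-- **`K_{1,2J}(x_l) ≤ ↑(jensenFarQ d Λ T N tmax J i l)`** (`d ≥ 3`, origin table `hT`).
[cite: FitznerVanDerHofstad2016NoBLE, §5.1.2 (5.16) p. 1092] -/
theorem srwK_le_jensenFarQ (hd : 3 ≤ d) {Λ : ℕ} {T : ℕ → ℚ} (hT : ∀ l ≤ Λ, srwI d 1 l 0 ≤ (T l : ℝ))
    (N tmax : ℕ) (J : ℕ → List ℕ → ℕ) (i : ℕ) (l : List ℕ) :
    srwK d 1 (2 * J i l) (canonSite d l) ≤ ((jensenFarQ d Λ T N tmax J i l : ℚ) : ℝ) := by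
  have hA := srwI_one_zero_le_srwIZeroExtQ hd hT (2 * J i l)
  have hB := jensenSum_le_jensenBoundQ hd hT (canonSite d l) (2 * J i l) N tmax
  have hA0 : (0 : ℝ) ≤ (srwIZeroExtQ d Λ T (2 * J i l) : ℚ) := (srwI_zero_even_nonneg 1 (J i l)).trans hA
  have hB0 : (0 : ℝ) ≤ (jensenBoundQ d (canonSite d l) (2 * J i l) N tmax Λ T : ℚ) :=
    (jensenSum_nonneg (n := 1) (by omega) (J i l) (canonSite d l)).trans hB
  obtain ⟨hF, hAB⟩ := amgmNewton_spec hA0 hB0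
  rw [jensenFarQ, amgmNewton]
  push_cast
  have h := srwK_le_of_jensen_cert (n := 1) (m := J i l) (j := J i l) (by omega) hA hB hF hAB
  rwa [← two_mul] at h

/-- The far value never exceeds the arithmetic mean of the cap and the Jensen majorant, hence never the cap when the
majorant does not exceed it. [cite: FitznerVanDerHofstad2016NoBLE, §5.1.2 (5.14)–(5.16) p. 1092] -/
theorem jensenFarQ_le_of_le {Λ : ℕ} {T : ℕ → ℚ} {N tmax : ℕ} {J : ℕ → List ℕ → ℕ} {i : ℕ} {l : List ℕ}
    (hA : 0 ≤ srwIZeroExtQ d Λ T (2 * J i l)) (hB : 0 ≤ jensenBoundQ d (canonSite d l) (2 * J i l) N tmax Λ T)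
    (h : jensenBoundQ d (canonSite d l) (2 * J i l) N tmax Λ T ≤ srwIZeroExtQ d Λ T (2 * J i l)) :
    jensenFarQ d Λ T N tmax J i l ≤ srwIZeroExtQ d Λ T (2 * J i l) := by
  rw [jensenFarQ, amgmNewton]
  set A := srwIZeroExtQ d Λ T (2 * J i l)
  set B := jensenBoundQ d (canonSite d l) (2 * J i l) N tmax Λ T
  by_cases hz : (A + B) / 2 = 0
  · have hA0 : A = 0 := by linarith
    have hB0 : B = 0 := by linarith
    simp [hA0, hB0]
  · have hGp : 0 < (A + B) / 2 := lt_of_le_of_ne (by positivity) (Ne.symm hz)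
    have h1 : A * B / ((A + B) / 2) ≤ (A + B) / 2 := by
      rw [div_le_iff₀ hGp]; nlinarith [sq_nonneg (A - B)]
    linarith

/-! ### §4b. Far-value tables certified class by class (chunkable)

One `decide +kernel` per ORDER of Jensen far values can be long; the table form lets a consumer certify a table
`f i l ≥ jensenFarQ … i l` chunk by chunk (`List.take` / `List.drop` of the class list, one `decide` each) and then run
the cheap order evaluator on the table `f`. -/

/-- `jensenFarLeTable d Λ T N tmax J i f ls`: every class `l ∈ ls` has `jensenFarQ d Λ T N tmax J i l ≤ f l` (a `Bool`,
one `decide +kernel` per chunk of classes). [cite: FitznerVanDerHofstad2016NoBLE, §5.3.3 p. 1098; §5.1.2 (5.16) p. 1092] -/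
def jensenFarLeTable (d Λ : ℕ) (T : ℕ → ℚ) (N tmax : ℕ) (J : ℕ → List ℕ → ℕ) (i : ℕ) (f : List ℕ → ℚ)
    (ls : List (List ℕ)) : Bool :=
  ls.all fun l => decide (jensenFarQ d Λ T N tmax J i l ≤ f l)

/-- Chunking a table check. [cite: FitznerVanDerHofstad2016NoBLE, §5.3.3 p. 1098] -/
theorem jensenFarLeTable_of_take_drop {Λ : ℕ} {T : ℕ → ℚ} {N tmax : ℕ} {J : ℕ → List ℕ → ℕ} {i : ℕ}
    {f : List ℕ → ℚ} {ls : List (List ℕ)} (n : ℕ) (h₁ : jensenFarLeTable d Λ T N tmax J i f (ls.take n) = true)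
    (h₂ : jensenFarLeTable d Λ T N tmax J i f (ls.drop n) = true) : jensenFarLeTable d Λ T N tmax J i f ls = true := by
  rw [← List.take_append_drop n ls]
  unfold jensenFarLeTable at *
  rw [List.all_append, h₁, h₂]; rfl

/-- A certified table dominates `K_{1,2J}(x_l)` on its class list (`d ≥ 3`, origin table `hT`).
[cite: FitznerVanDerHofstad2016NoBLE, §5.1.2 (5.16) p. 1092] -/
theorem srwK_le_of_jensenFarLeTable (hd : 3 ≤ d) {Λ : ℕ} {T : ℕ → ℚ} (hT : ∀ l ≤ Λ, srwI d 1 l 0 ≤ (T l : ℝ))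
    {N tmax : ℕ} {J : ℕ → List ℕ → ℕ} {i : ℕ} {f : List ℕ → ℚ} {ls : List (List ℕ)}
    (h : jensenFarLeTable d Λ T N tmax J i f ls = true) :
    ∀ l ∈ ls, srwK d 1 (2 * J i l) (canonSite d l) ≤ ((f l : ℚ) : ℝ) := by
  intro l hl
  unfold jensenFarLeTable at h
  have h' := (List.all_eq_true.1 h) l hl
  simp only [decide_eq_true_eq] at h'
  exact (srwK_le_jensenFarQ hd hT N tmax J i l).trans (by exact_mod_cast h')

/-- **The `WBX(M)` cell at the overlay reading, cut policy `J`, `W`-SPLIT/JENSEN FAR VALUES read off an origin table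
of any extent** — the binders of `WbxCellExactKernel.toReal_tsum_sq_weighted_repBubble_le_policyXBounds_of_originTable`
verbatim plus the evaluator parameters `N` (law depth) and `tmax` (type truncation), the far values
`jensenFarQ d Λ T N tmax J` in place of the extended origin column; every `q i` is one
`decide +kernel`.  Pointer language: an input-certification form, no statement about any dimension.
[cite: FitznerVanDerHofstad2016NoBLE, §5.3.1 (5.36)–(5.38) with §5.3.3 p. 1098; §5.1.2 (5.16) p. 1092; (5.14)]
[cite: FitznerVanDerHofstad2017, §4.2 (4.18)]
[cite: MadrasSlade1993, Cor. 5.3.2 (5.3.3) (reprint PDF p. 148)] -/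
theorem toReal_tsum_sq_weighted_repBubble_le_policyXBounds_jensen_of_originTable {ι : Type*} [Fintype ι]
    [Nonempty ι] (hd : 3 ≤ d) {p : unitInterval} (hp : p ∈ Set.Ioo (nbwThresholdI d) (criticalProbI d))
    (m M : ℕ) {J : ℕ → List ℕ → ℕ} (hJ : ∀ i ∈ Icc m M, ∀ l ∈ liveList d i, i ≤ 2 * J i l)
    {𝒮 : ι → ℕ × ℕ × Set (Site d)} {cμ : ℝ} {c : ι → ℝ} (hc : ∀ k, 0 < c k) {γ : Fin 3 → ℚ}
    (hΓ : ∀ i, nobleFOf 𝒮 cμ c i p ≤ (γ i : ℝ)) {k : ι} (hk : 𝒮 k = (1, M + 1, {(0 : Site d)}))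
    {z : ℚ} (hpz : (p : ℝ) ≤ (z : ℝ)) {Λ : ℕ} {T : ℕ → ℚ} (hT : ∀ l ≤ Λ, srwI d 1 l 0 ≤ (T l : ℝ)) (N tmax : ℕ)
    {q : ℕ → ℚ} (hq : ∀ i ∈ Icc m M, wbxOrderPolicyXQ d i (J i) z (γ 1) (jensenFarQ d Λ T N tmax J i) ≤ q i) :
    (∑' y : Site d, ENNReal.ofReal (euclidNorm y ^ 2) *
        bondPercolation (zdGraph d) p (openConnGe m (0 : Site d) y □ openConn y 0)).toReal ≤
      (∑ i ∈ Icc m M, (z : ℝ) ^ i * (q i : ℝ)) + (2 * d * (z : ℝ)) ^ (M + 1) * ((γ 2 : ℝ) * c k) :=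
  toReal_tsum_sq_weighted_repBubble_le_policyXBounds_of_farValues hd hp m M hJ hc hΓ hk hpz
    (fun i _ l _ => srwK_le_jensenFarQ hd hT N tmax J i l) hq

/-- **The same cell with a CERTIFIED FAR-VALUE TABLE** `f` (`jensenFarLeTable … i (f i) (liveList d i) = true` for each
order, provable chunk by chunk with `jensenFarLeTable_of_take_drop`), the order evaluator then running on the table.
[cite: FitznerVanDerHofstad2016NoBLE, §5.3.1 (5.36)–(5.38) with §5.3.3 p. 1098; §5.1.2 (5.16) p. 1092; (5.14)]
[cite: FitznerVanDerHofstad2017, §4.2 (4.18)]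
[cite: MadrasSlade1993, Cor. 5.3.2 (5.3.3) (reprint PDF p. 148)] -/
theorem toReal_tsum_sq_weighted_repBubble_le_policyXBounds_jensenTable_of_originTable {ι : Type*} [Fintype ι]
    [Nonempty ι] (hd : 3 ≤ d) {p : unitInterval} (hp : p ∈ Set.Ioo (nbwThresholdI d) (criticalProbI d))
    (m M : ℕ) {J : ℕ → List ℕ → ℕ} (hJ : ∀ i ∈ Icc m M, ∀ l ∈ liveList d i, i ≤ 2 * J i l)
    {𝒮 : ι → ℕ × ℕ × Set (Site d)} {cμ : ℝ} {c : ι → ℝ} (hc : ∀ k, 0 < c k) {γ : Fin 3 → ℚ}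
    (hΓ : ∀ i, nobleFOf 𝒮 cμ c i p ≤ (γ i : ℝ)) {k : ι} (hk : 𝒮 k = (1, M + 1, {(0 : Site d)}))
    {z : ℚ} (hpz : (p : ℝ) ≤ (z : ℝ)) {Λ : ℕ} {T : ℕ → ℚ} (hT : ∀ l ≤ Λ, srwI d 1 l 0 ≤ (T l : ℝ)) {N tmax : ℕ}
    {f : ℕ → List ℕ → ℚ} (hf : ∀ i ∈ Icc m M, jensenFarLeTable d Λ T N tmax J i (f i) (liveList d i) = true)
    {q : ℕ → ℚ} (hq : ∀ i ∈ Icc m M, wbxOrderPolicyXQ d i (J i) z (γ 1) (f i) ≤ q i) :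
    (∑' y : Site d, ENNReal.ofReal (euclidNorm y ^ 2) *
        bondPercolation (zdGraph d) p (openConnGe m (0 : Site d) y □ openConn y 0)).toReal ≤
      (∑ i ∈ Icc m M, (z : ℝ) ^ i * (q i : ℝ)) + (2 * d * (z : ℝ)) ^ (M + 1) * ((γ 2 : ℝ) * c k) :=
  toReal_tsum_sq_weighted_repBubble_le_policyXBounds_of_farValues hd hp m M hJ hc hΓ hk hpz
    (fun i hi l hl => srwK_le_of_jensenFarLeTable hd hT (hf i hi) l hl) hq

/-! ### §5. Toy examples (`d = 3`), kernel-decided -/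

/-- The doubled-type multiplicity list. -/
example : doubledMult [2, 0, 1] = [0, 2, 0, 0, 0, 1] := by decide

/-- The memo of `x = (1,1,0) ∈ ℤ³` has the three types `t ∈ {0,1,2}` of value `2`. -/
example : ((jensenMemo 3 (canonSite 3 [2]) 4 2 4 fun l => (l : ℚ)).map fun e => e.2.1) =
    [[], [2], [2, 2]] := by decide +kernel

/-- With the linear toy table `T l = l` (`Λ = 4`) the Jensen value of the class `[2]` at cut `4`, `N = 2`, is a
definite rational below the cap `T 4 = 4`. -/
example : jensenBoundQ 3 (canonSite 3 [2]) 4 2 3 4 (fun l => (l : ℚ)) < 4 := by decide +kernel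

/-- Truncation is monotone in cost and value: `tmax = 0` bounds every term by the `U = ∅` entry (the origin value),
`tmax ≥ s` evaluates every type. -/
example : jensenBoundQ 3 (canonSite 3 [2]) 4 2 3 4 (fun l => (l : ℚ)) ≤
    jensenBoundQ 3 (canonSite 3 [2]) 4 2 0 4 (fun l => (l : ℚ)) := by decide +kernel

/-- … hence the far value (Newton value of cap and majorant) is below the cap as well. -/
example : jensenFarQ 3 4 (fun l => (l : ℚ)) 2 3 (fun _ _ => 2) 5 [2] < srwIZeroExtQ 3 4 (fun l => (l : ℚ)) 4 := by
  decide +kernel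

/-- A two-class far-value table at `d = 3`, certified in two chunks. -/
example : jensenFarLeTable 3 4 (fun l => (l : ℚ)) 2 3 (fun _ _ => 2) 5 (fun _ => 4) [[2], [1, 1]] = true :=
  jensenFarLeTable_of_take_drop 1 (by decide +kernel) (by decide +kernel)

/-- The Newton value of `A = 4`, `B = 1`: `5/2 → (5/2 + 4/(5/2))/2 = 41/20 ≥ √4 = 2`. -/
example : amgmNewton 4 1 = 41 / 20 := by norm_num [amgmNewton]

end Literature.Probability.FitznerVanDerHofstad2017
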